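import Summits.CriticalPhenomena.PercolationContinuityZ3.Theorems.PercNearOneGluingNoHeavyLowerTailSahiStrongCubicMax
import Mathlib.Combinatorics.SetFamily.FourFunctions
import Mathlib.Tactic.Linarith
import HarnessLib

/-!
# `NoHeavyLowerTail` (crux stmt-CriticalPhenomena-4575), master-family line P1 (gen 26):
# JOINS × MEETS — the Ahlswede–Daykin bound `μ(X)·μ(Y) ≤ μ(X ∨ Y)·μ(X ∧ Y)` under any FKG weight, and the two-function shadows of the
# rainbow-join conjecture: every pair of petals is paid by its cross joins times its cross meets

Support file (seat `prim-masterthm-p1`, gen 26; `--supports stmt-CriticalPhenomena-4575`).  Two definitions (`setJoins`, `setMeets`), no `sorry`,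
standard axioms.  Memo `run/shared/lean/prim/prim-masterthm/FROM-prim-masterthm-p1-g26-RAINBOW-JOINS.md` §0 (anchor theorems).

CONTENT (all [this work] as packaging; the inequality is Ahlswede–Daykin's four functions theorem, Mathlib `four_functions_theorem`).
* `setJoins X Y = {a ⊔ b : a ∈ X, b ∈ Y}`, `setMeets X Y = {a ⊓ b}` on a finite distributive lattice.
* `ex_ind_mul_le_joins_meets`: for an FKG weight `μ` (`IsFKGMeasure`: nonnegative, log-supermodular) and ANY `X, Y`:
  **`E_μ(1_X)·E_μ(1_Y) ≤ E_μ(1_{X∨Y})·E_μ(1_{X∧Y})`** — four functions `μ1_X, μ1_Y, μ1_{X∧Y}, μ1_{X∨Y}`.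
* Sunflower shadows (tree `SahiDeepCore`, sandwiched triple `(A,B,N)`, product weight): for each pair of petals the product of their masses is at most
  (mass of their cross joins) × (mass of their cross meets): `petals_le_joins_meets_AB` (`α·β`), `…_AD` (`α·d`), `…_BD` (`β·d`); the cross joins lie in the
  core and the cross meets in the outside (`setJoins_petals_subset_core`, `setMeets_petals_subset_outside`), so these refine the three Harris/AD instances
  `c_ic_j ≤ κ·o` behind Gladkov's inequality.  The THREE-function analogue `e₃ ≤ μ(J)·μ(M)` (rainbow joins × rainbow meets) is Aharoni–Keich's theorem
  (not formalised); the conjecture `StrongCubicJoinNonneg` of `…SahiRainbowJoins` replaces `μ(M)` there by Gladkov's defect.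
-/

noncomputable section

open scoped Classical
open scoped FinsetFamily

namespace Summit.CriticalPhenomena.PercolationContinuityZ3.Theorems

namespace SahiDeepCore

open Finset
open Literature.Combinatorics.Sahi2008
open Literature.Probability.Percolation.DecisionTree (ind ind_of_mem ind_of_not_mem ind_nonneg)

/-! ### 1. Joins and meets of two families; the Ahlswede–Daykin bound under an FKG weight -/

section Lattice

variable {L : Type*} [DistribLattice L] [Fintype L]

omit [Fintype L] in
/-- The joins `{a ⊔ b : a ∈ X, b ∈ Y}` of two families. [this work] -/
def setJoins (X Y : Set L) : Set L := {c | ∃ a ∈ X, ∃ b ∈ Y, c = a ⊔ b}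

omit [Fintype L] in
/-- The meets `{a ⊓ b : a ∈ X, b ∈ Y}` of two families. [this work] -/
def setMeets (X Y : Set L) : Set L := {c | ∃ a ∈ X, ∃ b ∈ Y, c = a ⊓ b}

/-- **Ahlswede–Daykin for two families under an FKG weight**: `E(1_X)·E(1_Y) ≤ E(1_{X∨Y})·E(1_{X∧Y})`.
[cite: AhlswedeDaykin1978, Thm. 1] -/
theorem ex_ind_mul_le_joins_meets {μ : L → ℝ} (hμ : IsFKGMeasure μ) (X Y : Set L) :
    ex μ (ind X) * ex μ (ind Y) ≤ ex μ (ind (setJoins X Y)) * ex μ (ind (setMeets X Y)) := by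
  -- the four functions
  set f₁ : L → ℝ := fun a => μ a * ind X a
  set f₂ : L → ℝ := fun a => μ a * ind Y a
  set f₃ : L → ℝ := fun a => μ a * ind (setMeets X Y) a
  set f₄ : L → ℝ := fun a => μ a * ind (setJoins X Y) a
  have h₁ : 0 ≤ f₁ := fun a => mul_nonneg (hμ.nonneg a) (ind_nonneg _ _)
  have h₂ : 0 ≤ f₂ := fun a => mul_nonneg (hμ.nonneg a) (ind_nonneg _ _)
  have h₃ : 0 ≤ f₃ := fun a => mul_nonneg (hμ.nonneg a) (ind_nonneg _ _)
  have h₄ : 0 ≤ f₄ := fun a => mul_nonneg (hμ.nonneg a) (ind_nonneg _ _)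
  have hpt : ∀ a b, f₁ a * f₂ b ≤ f₃ (a ⊓ b) * f₄ (a ⊔ b) := by
    intro a b
    by_cases ha : a ∈ X
    · by_cases hb : b ∈ Y
      · have hm : a ⊓ b ∈ setMeets X Y := ⟨a, ha, b, hb, rfl⟩
        have hj : a ⊔ b ∈ setJoins X Y := ⟨a, ha, b, hb, rfl⟩
        simp only [f₁, f₂, f₃, f₄, ind_of_mem ha, ind_of_mem hb, ind_of_mem hm, ind_of_mem hj, mul_one]
        exact hμ.mul_le_mul a b
      · simp only [f₁, f₂, ind_of_not_mem hb, mul_zero]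
        exact mul_nonneg (h₃ _) (h₄ _)
    · simp only [f₁, ind_of_not_mem ha, mul_zero, zero_mul]
      exact mul_nonneg (h₃ _) (h₄ _)
  have h := four_functions_theorem f₁ f₂ f₃ f₄ h₁ h₂ h₃ h₄ hpt Finset.univ Finset.univ
  -- sums over sub-finsets of `univ` are at most the full sums (nonnegative summands)
  have hs3 : ∑ a ∈ Finset.univ ⊼ Finset.univ, f₃ a ≤ ∑ a, f₃ a :=
    Finset.sum_le_sum_of_subset_of_nonneg (Finset.subset_univ _) fun a _ _ => h₃ a
  have hs4 : ∑ a ∈ Finset.univ ⊻ Finset.univ, f₄ a ≤ ∑ a, f₄ a :=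
    Finset.sum_le_sum_of_subset_of_nonneg (Finset.subset_univ _) fun a _ _ => h₄ a
  have hn4 : 0 ≤ ∑ a ∈ Finset.univ ⊻ Finset.univ, f₄ a := Finset.sum_nonneg fun a _ => h₄ a
  have hn3 : 0 ≤ ∑ a, f₃ a := Finset.sum_nonneg fun a _ => h₃ a
  have hfin : (∑ a, f₁ a) * ∑ a, f₂ a ≤ (∑ a, f₃ a) * ∑ a, f₄ a :=
    h.trans (mul_le_mul hs3 hs4 hn4 hn3)
  simpa only [ex_def, f₁, f₂, f₃, f₄, mul_comm] using hfin

end Lattice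

/-! ### 2. Sunflower shadows: every pair of petals is paid by its cross joins × cross meets -/

variable {ι : Type} [Fintype ι]

local notation3 (prettyPrint := false) "m⟦" p ", " X "⟧" => ex (bernoulliWeight p) (ind X)

omit [Fintype ι] in
/-- Cross joins of two petals of a sandwiched triple lie in the core `A ∩ B ∩ N` — here for the petals `A∖B`, `B∖A`. [this work] -/
theorem setJoins_petals_subset_core {A B N : Set (Set ι)} (hA : IsUpperSet A) (hB : IsUpperSet B) (hN : IsUpperSet N)
    (hAB : A \ B ⊆ N) : setJoins (A \ B) (B \ A) ⊆ A ∩ B ∩ N := by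
  rintro c ⟨x, hx, y, hy, rfl⟩
  exact ⟨⟨hA (le_sup_left : x ≤ x ⊔ y) hx.1, hB (le_sup_right : y ≤ x ⊔ y) hy.1⟩, hN (le_sup_left : x ≤ x ⊔ y) (hAB hx)⟩

omit [Fintype ι] in
/-- Cross meets of the petals `A∖B`, `B∖A` lie in the outside `(A ∪ B)ᶜ`. [this work] -/
theorem setMeets_petals_subset_outside {A B : Set (Set ι)} (hA : IsUpperSet A) (hB : IsUpperSet B) :
    setMeets (A \ B) (B \ A) ⊆ (A ∪ B)ᶜ := by
  rintro c ⟨x, hx, y, hy, rfl⟩ (h | h)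
  · exact hy.2 (hA (inf_le_right : x ⊓ y ≤ y) h)
  · exact hx.2 (hB (inf_le_left : x ⊓ y ≤ x) h)

/-- **`α·β ≤ μ(joins)·μ(meets)`** for the petals `A∖B`, `B∖A` under the product weight (refines the AD instance `αβ ≤ κ·o`). [this work] -/
theorem petals_le_joins_meets_AB (p : ι → unitInterval) (A B : Set (Set ι)) :
    m⟦p, A \ B⟧ * m⟦p, B \ A⟧ ≤ m⟦p, setJoins (A \ B) (B \ A)⟧ * m⟦p, setMeets (A \ B) (B \ A)⟧ :=
  ex_ind_mul_le_joins_meets (isFKGMeasure_bernoulliWeight p) _ _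

/-- **`α·d ≤ μ(joins)·μ(meets)`** for the petals `A∖B`, `(A∩B)∖N`. [this work] -/
theorem petals_le_joins_meets_AD (p : ι → unitInterval) (A B N : Set (Set ι)) :
    m⟦p, A \ B⟧ * m⟦p, (A ∩ B) \ N⟧ ≤
      m⟦p, setJoins (A \ B) ((A ∩ B) \ N)⟧ * m⟦p, setMeets (A \ B) ((A ∩ B) \ N)⟧ :=
  ex_ind_mul_le_joins_meets (isFKGMeasure_bernoulliWeight p) _ _

/-- **`β·d ≤ μ(joins)·μ(meets)`** for the petals `B∖A`, `(A∩B)∖N`. [this work] -/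
theorem petals_le_joins_meets_BD (p : ι → unitInterval) (A B N : Set (Set ι)) :
    m⟦p, B \ A⟧ * m⟦p, (A ∩ B) \ N⟧ ≤
      m⟦p, setJoins (B \ A) ((A ∩ B) \ N)⟧ * m⟦p, setMeets (B \ A) ((A ∩ B) \ N)⟧ :=
  ex_ind_mul_le_joins_meets (isFKGMeasure_bernoulliWeight p) _ _

end SahiDeepCore

end Summit.CriticalPhenomena.PercolationContinuityZ3.Theorems
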